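import Literature.Barriers.ResolutionOfSingularities.LocalMonomializationFailsTowers
import Literature.Barriers.ResolutionOfSingularities.LocalMonomializationFailsAlgebraic
import Mathlib.RingTheory.Valuation.LocalSubring
import HarnessLib

/-!
# Cutkosky's counterexample: the valuation `ν*` and the classification of the `B'`

`Literature/Barriers/ResolutionOfSingularities/LocalMonomializationFailsValuation.lean` — §3,
p. 7 of Cutkosky's paper over the base field `F`: "`V* = ∪_{i≥0} B_i` is a valuation ring of
`K*` … (by Lemma 2.2)" and "The top row of (12) is the complete list of all two dimensional
regular algebraic local rings of `K*` dominating `B` and dominated by `V*` (by Theorem 2.1)",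
GRANTED Lemma 3.1 (`CutkoskyLemma31`, to build the tower), Lemma 2.2 (`AbhyankarQuadraticUnion`)
and Theorem 2.1 (`AbhyankarQuadraticFactorization`). PROVED here: the union of the tower is a
local ring dominated by a valuation ring `V*` (Chevalley), along which every step of the tower is
THE quadratic transform; hence (Lemma 2.2) `V* = ∪ B_l`, every element of `V*` is a scalar modulo
`𝔪_{V*}` (all `B_l` have residue field `F`); hence every regular algebraic local ring `B'` of
`L = K*` dominated by `V*` and dominating `B` is two-dimensional
(`LocalMonomializationFailsAlgebraic.lean`) and therefore (Theorem 2.1) equal to some `B_l`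
(`eq_Bring_of_dominated`). [cite: Cutkosky2014, §3 (p. 7)]
-/

noncomputable section

namespace Literature.Barriers.ResolutionOfSingularities

namespace Cutkosky

open Literature.AlgebraicGeometry.Resolution IsLocalRing
open scoped IntermediateField

universe u

variable {F : Type u} [Field F] {L : Type u} [Field L] [Algebra F L]
variable (p : ℕ) [hp : Fact p.Prime] [CharP F p] {x y : L} (hxy : AlgebraicIndependent F ![x, y])
  (hgen : IntermediateField.adjoin F {x, y} = ⊤)
  (h3 : ∃ a b c : F, a ≠ b ∧ b ≠ c ∧ a ≠ c) (hL : CutkoskyLemma31.{u})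

/-! ## The tower is a chain of dominations -/

/-- `B_l` is a local ring. [cite: Cutkosky2014, §3] -/
theorem isLocalRing_Bring (l : ℕ) : IsLocalRing (Bring p hxy hgen h3 hL l) :=
  isLocalRing_originLocalRing _

/-- `B_l` is a regular local ring. [cite: Cutkosky2014, §3] -/
theorem isRegularLocalRing_Bring' (l : ℕ) : IsRegularLocalRing (Bring p hxy hgen h3 hL l) :=
  isRegularLocalRing_originLocalRing _

/-- `B_l ⊆ B_{l+1}`. [cite: Cutkosky2014, §3 (12)] -/
theorem Bring_le_succ (l : ℕ) : Bring p hxy hgen h3 hL l ≤ Bring p hxy hgen h3 hL (l + 1) :=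
  (Bring_succ p hxy hgen h3 hL l).2.1

/-- The tower is increasing. [cite: Cutkosky2014, §3 (12)] -/
theorem Bring_mono : Monotone (Bring p hxy hgen h3 hL) :=
  monotone_nat_of_le_succ (Bring_le_succ p hxy hgen h3 hL)

/-- Later members of the tower dominate earlier ones. [cite: Cutkosky2014, §3 (12)] -/
theorem Bring_dominates_of_le {l l' : ℕ} (h : l ≤ l') :
    SubringDominates (Bring p hxy hgen h3 hL l).toSubring (Bring p hxy hgen h3 hL l').toSubring := by
  induction h with
  | refl => exact SubringDominates.refl _
  | step _ ih => exact ih.trans (Bring_succ p hxy hgen h3 hL _).2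

/-! ## The union of the tower and the valuation ring `V*` -/

/-- `∪_l B_l ⊆ L` as a subring. [cite: Cutkosky2014, §3 (p. 7)] -/
def unionB : Subring L := ⨆ l, (Bring p hxy hgen h3 hL l).toSubring

/-- Membership in the union. [folklore] -/
theorem mem_unionB_iff {z : L} : z ∈ unionB p hxy hgen h3 hL ↔ ∃ l, z ∈ Bring p hxy hgen h3 hL l := by
  unfold unionB
  rw [Subring.mem_iSup_of_directed]
  · rfl
  · exact (Bring_mono p hxy hgen h3 hL).directed_le.mono_comp _ (fun _ _ h => h)

/-- `B_l ⊆ ∪ B`. [folklore] -/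
theorem Bring_le_unionB (l : ℕ) : (Bring p hxy hgen h3 hL l).toSubring ≤ unionB p hxy hgen h3 hL :=
  fun _ hz => (mem_unionB_iff p hxy hgen h3 hL).mpr ⟨l, hz⟩

/-- **The union of the tower is a local ring** (an increasing union of local rings). [folklore] -/
theorem isLocalRing_unionB : IsLocalRing (unionB p hxy hgen h3 hL) := by
  refine IsLocalRing.of_isUnit_or_isUnit_one_sub_self fun a => ?_
  obtain ⟨l, hl⟩ := (mem_unionB_iff p hxy hgen h3 hL).mp a.2
  haveI := isLocalRing_Bring p hxy hgen h3 hL l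
  have key := IsLocalRing.isUnit_or_isUnit_one_sub_self (⟨(a : L), hl⟩ : Bring p hxy hgen h3 hL l)
  let ι : (Bring p hxy hgen h3 hL l).toSubring →+* unionB p hxy hgen h3 hL :=
    Subring.inclusion (Bring_le_unionB p hxy hgen h3 hL l)
  have ha : ι ⟨(a : L), hl⟩ = a := Subtype.ext rfl
  have h1a : ι (1 - ⟨(a : L), hl⟩) = 1 - a := by rw [map_sub, map_one, ha]
  rcases key with h | h
  · left; rw [← ha]; exact h.map ι
  · right; rw [← h1a]; exact h.map ι

/-- **The union of the tower dominates each `B_l`.** [folklore] -/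
theorem dominates_unionB (l : ℕ) :
    SubringDominates (Bring p hxy hgen h3 hL l).toSubring (unionB p hxy hgen h3 hL) := by
  refine ⟨Bring_le_unionB p hxy hgen h3 hL l, fun z hz hzinv => ?_⟩
  obtain ⟨l', hl'⟩ := (mem_unionB_iff p hxy hgen h3 hL).mp hzinv
  have h := Bring_dominates_of_le p hxy hgen h3 hL (le_max_left l l')
  exact h.2 z hz (Bring_mono p hxy hgen h3 hL (le_max_right l l') hl')

/-- The union of the tower as a local subring. [folklore] -/
def unionLocalSubring : LocalSubring L :=
  @LocalSubring.mk L _ (unionB p hxy hgen h3 hL) (isLocalRing_unionB p hxy hgen h3 hL)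

/-- **`V*`**: a valuation ring of `L = K*` dominating the union of the tower (Chevalley; it will
turn out to be the union itself, `mem_Vstar_iff`). [cite: Cutkosky2014, §3 (p. 7)] -/
def Vstar : ValuationSubring L :=
  Classical.choose (unionLocalSubring p hxy hgen h3 hL).exists_le_valuationSubring

/-- `V*` dominates the union of the tower. [cite: Cutkosky2014, §3 (p. 7)] -/
theorem dominates_unionB_Vstar :
    SubringDominates (unionB p hxy hgen h3 hL) (Vstar p hxy hgen h3 hL).toSubring := by
  have h := Classical.choose_spec (unionLocalSubring p hxy hgen h3 hL).exists_le_valuationSubring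
  haveI := isLocalRing_unionB p hxy hgen h3 hL
  haveI : IsLocalRing (Vstar p hxy hgen h3 hL).toSubring := (Vstar p hxy hgen h3 hL).toLocalSubring.isLocalRing
  rw [subringDominates_iff]
  exact h

/-- **`V*` dominates every `B_l`.** [cite: Cutkosky2014, §3 (p. 7)] -/
theorem dominates_Bring_Vstar (l : ℕ) :
    SubringDominates (Bring p hxy hgen h3 hL l).toSubring (Vstar p hxy hgen h3 hL).toSubring :=
  (dominates_unionB p hxy hgen h3 hL l).trans (dominates_unionB_Vstar p hxy hgen h3 hL)

/-- **Each step of the tower is the quadratic transform along `V*`.** [cite: Cutkosky2014, §3 (12)] -/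
theorem isQuadraticTransformAlong_Bring (l : ℕ) :
    IsQuadraticTransformAlong (Vstar p hxy hgen h3 hL) (Bring p hxy hgen h3 hL l).toSubring
      (Bring p hxy hgen h3 hL (l + 1)).toSubring := by
  refine (Bring_succ p hxy hgen h3 hL l).1.along ?_ (dominates_Bring_Vstar p hxy hgen h3 hL (l + 1))
  haveI := isRegularLocalRing_Bring' p hxy hgen h3 hL l
  have hfg : (maximalIdeal (Bring p hxy hgen h3 hL l)).FG := IsNoetherian.noetherian _
  exact ⟨(inferInstance : IsLocalRing (Bring p hxy hgen h3 hL l)), hfg⟩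

/-- `B₀ = B` is a local ring of `L` (its fraction field is `L = F(x,y)`). [cite: Cutkosky2014, §3] -/
theorem isLocalRingOf_Bring_zero : IsLocalRingOf (Bring p hxy hgen h3 hL 0).toSubring := by
  rw [Bring_zero]
  refine ⟨isLocalRing_originLocalRing hxy, fun z => ?_⟩
  have hz : z ∈ IntermediateField.adjoin F (Set.range ![x, y]) := by
    rw [range_pair, hgen]; exact IntermediateField.mem_top
  obtain ⟨r, s, rfl⟩ := (IntermediateField.mem_adjoin_range_iff F _ _).mp hz
  by_cases hs : MvPolynomial.aeval ![x, y] s = 0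
  · exact ⟨0, Subalgebra.zero_mem _, 1, Subalgebra.one_mem _, one_ne_zero, by rw [hs]; simp⟩
  · exact ⟨_, aeval_mem_originLocalRing hxy r, _, aeval_mem_originLocalRing hxy s, hs, rfl⟩

/-- `B₀` is a regular local ring of dimension two. [cite: Cutkosky2014, §3] -/
theorem isRegularLocalRing_Bring (l : ℕ) : IsRegularLocalRing (Bring p hxy hgen h3 hL l).toSubring :=
  isRegularLocalRing_originLocalRing (algebraicIndependent_Bfam p hxy hgen h3 hL l)

/-- `dim B_l = 2`. [cite: Cutkosky2014, §3] -/
theorem ringKrullDim_Bring (l : ℕ) : ringKrullDim (Bring p hxy hgen h3 hL l).toSubring = 2 := by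
  have := ringKrullDim_originLocalRing (algebraicIndependent_Bfam p hxy hgen h3 hL l)
  exact this

/-- **`V* = ∪_l B_l`** (Lemma 2.2, granted as `AbhyankarQuadraticUnion`).
[cite: Cutkosky2014, §3 (p. 7) and Lemma 2.2] -/
theorem mem_Vstar_iff (hU : AbhyankarQuadraticUnion.{u}) (z : L) :
    z ∈ Vstar p hxy hgen h3 hL ↔ ∃ l, z ∈ Bring p hxy hgen h3 hL l :=
  hU L (Vstar p hxy hgen h3 hL) (fun n => (Bring p hxy hgen h3 hL n).toSubring)
    (isRegularLocalRing_Bring p hxy hgen h3 hL 0) (ringKrullDim_Bring p hxy hgen h3 hL 0)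
    (isLocalRingOf_Bring_zero p hxy hgen h3 hL) (dominates_Bring_Vstar p hxy hgen h3 hL 0)
    (isQuadraticTransformAlong_Bring p hxy hgen h3 hL) z

/-- **Every element of `V*` is a scalar modulo `𝔪_{V*}`** (residue field `F`: `V* = ∪ B_l` and
each `B_l = F[x_l,y_l]_{(x_l,y_l)}` has residue field `F`). [cite: Cutkosky2014, §3 (p. 7)] -/
theorem Vstar_residue (hU : AbhyankarQuadraticUnion.{u}) (z : L) (hz : z ∈ Vstar p hxy hgen h3 hL) :
    ∃ c : F, (Vstar p hxy hgen h3 hL).valuation (z - algebraMap F L c) < 1 := by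
  obtain ⟨l, hl⟩ := (mem_Vstar_iff p hxy hgen h3 hL hU z).mp hz
  haveI := isLocalRing_Bring p hxy hgen h3 hL l
  obtain ⟨c, hc⟩ := exists_sub_algebraMap_mem_maximalIdeal (algebraicIndependent_Bfam p hxy hgen h3 hL l) ⟨z, hl⟩
  refine ⟨c, ?_⟩
  have hdom := dominates_Bring_Vstar p hxy hgen h3 hL l
  haveI : IsLocalRing (Bring p hxy hgen h3 hL l).toSubring := isLocalRing_Bring p hxy hgen h3 hL l
  have key := ((subringDominates_valuationSubring_iff hdom.1).mp hdom
    ⟨z - algebraMap F L c, (Bring p hxy hgen h3 hL l).sub_mem hl (Subalgebra.algebraMap_mem _ c)⟩).mp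
  exact key hc

include hxy hgen in
/-- `trdeg_F L = 2` (`x, y` is a transcendence basis). [cite: Cutkosky2014, §3] -/
theorem trdeg_L : Algebra.trdeg F L = 2 := by
  haveI : Algebra.IsAlgebraic (Algebra.adjoin F (Set.range ![x, y])) L := by
    haveI := isAlgebraic_of_adjoin_eq_top (F := F) (L := L) (S := Set.range ![x, y])
      (by rw [range_pair]; exact hgen)
    open scoped IntermediateField.algebraAdjoinAdjoin in
    exact Algebra.IsAlgebraic.trans (Algebra.adjoin F (Set.range ![x, y]))
      (IntermediateField.adjoin F (Set.range ![x, y])) L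
  have hb : IsTranscendenceBasis F ![x, y] := hxy.isTranscendenceBasis_iff_isAlgebraic.mpr inferInstance
  have h := hb.lift_cardinalMk_eq_trdeg
  simp only [Cardinal.mk_fintype, Fintype.card_fin, Cardinal.lift_natCast] at h
  have h' : Cardinal.lift.{0} (Algebra.trdeg F L) = Cardinal.lift.{0} (2 : Cardinal.{u}) := by
    rw [← h]; simp
  exact Cardinal.lift_injective h'

/-- **The classification of the `B'`** ("the top row of (12) is the complete list of all two
dimensional regular algebraic local rings of `K*` dominating `B` and dominated by `V*`",
granted Theorem 2.1 and Lemma 2.2): every regular algebraic local ring `B'` of `L` (over `F`)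
dominated by `V*` and dominating `B = B₀` is one of the `B_l`. [cite: Cutkosky2014, §3 (p. 7)] -/
theorem eq_Bring_of_dominated (hF : AbhyankarQuadraticFactorization.{u}) (hU : AbhyankarQuadraticUnion.{u})
    {B' : Subalgebra F L} (hB' : IsAlgebraicLocalRingOf F L ⊤ B') (hreg : IsRegularLocalRing B')
    (hdomV : ValuationDominates F L (Vstar p hxy hgen h3 hL) B')
    (hdom0 : Dominates F L (Bring p hxy hgen h3 hL 0) B') :
    ∃ l, B' = Bring p hxy hgen h3 hL l := by
  have hdim : ringKrullDim B' = 2 :=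
    ringKrullDim_eq_of_isAlgebraicLocalRingOf hB' hdomV.1 (Vstar_residue p hxy hgen h3 hL hU) (trdeg_L hxy hgen)
  obtain ⟨n, hn⟩ := AbhyankarQuadraticFactorization.exists_eq_of_dominated hF
    (O := Vstar p hxy hgen h3 hL) (R := fun n => (Bring p hxy hgen h3 hL n).toSubring)
    (isRegularLocalRing_Bring p hxy hgen h3 hL 0) (ringKrullDim_Bring p hxy hgen h3 hL 0)
    (isLocalRingOf_Bring_zero p hxy hgen h3 hL) (isQuadraticTransformAlong_Bring p hxy hgen h3 hL)
    (S := B'.toSubring) hreg hdim hdom0 hdomV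
  exact ⟨n, Subalgebra.toSubring_injective hn⟩

end Cutkosky

end Literature.Barriers.ResolutionOfSingularities

end
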